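import Summits.QuantumFields.YangMills.Theorems.BalabanUVNodesN20KeyedRelWeightFraction
import Summits.QuantumFields.YangMills.Theorems.BalabanUVNodesN20TwoRunKeyedPersistentWeight
import Summits.QuantumFields.YangMills.Theorems.BalabanUVNodesN20CoreEdgeAtShellSplitOfRecord

/-!
# BalabanUVNodes ∕ N20 (NE7b) — AT THE TOP OF THE WINDOW (`jcut K = K₀ + K`) THE GOOD CLASS OF THE SPINE READING OF RECORD IS THE SINGLE ALL-SMALL-FIELD KEY, AND THE N20 FACE
# IS «THE PURE SMALL-FIELD TERM EXHAUSTS BOTH DRESSED PARTITION FUNCTIONS UP TO A SUMMABLE DEFECT» — King's (3.10)–(3.11) shape read at the record.  With the (2.1) chain antitone,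
# «a large-field region at some level `≤ K₀ + K`» is «`Λ_{K₀+K} ≠ T_η`», and an admissible index with `Λ_{last} = T_η` IS the no-large-field index `Seq.top`; run B's key fibre over that
# key is the single `Seq.top` one cutoff up (flow-free).  So at the top cut the persistence class is EVERYTHING BUT the small-field key, its canonical weight on a live tuple is
# `W K = 1 − inf_{|t| ≤ 1} min (sf_A(t) ∕ Z_{K₀+K}(t), sf_B(t) ∕ Z_{K₀+K+1}(t))`, and the face says `(1 − W K) · Z ≤ sf` in both runs with `Σ W < ∞`

Cell `pub-ymgap` (HUMAN RULING D-0062 Track A; work-bound push D-0149, director-ym №197), width seat `pub-ymgap-dag-n20-w2` (gen 2) on node N20 = NE7b; CLAIM-4 of the re-seat,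
the third point of the dial after gen 0's ZERO cut (`…N20KeyedRelWeightCutZero`, free) and CLAIM-1's OVER-cut (`…OverCut`, excluded): the TOP of the window.  Filed `--kind proof
--supports stmt-QuantumFields-20544 --as helper` (K3⁷ `SpineGivenEndpointR13SepCoPH`); COUNT-NEUTRAL; LOCATED.  [III] = [Balaban1988Convergent], [LF-I∕II] = [Balaban1989LargeFieldI∕II].

WHY.  `T4WeightBudget` :117 names the PRINTED MODEL of `RelWeightBound`: King's large-field complement (3.10)–(3.11) — the class of ALL histories with a large field somewhere, whose
relative weight carries a positive power of the lattice spacing in `d = 2, 3` («exactly what `d = 4` lacks»).  At the spine reading of record that model IS the top of the dial: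
* §1 ((2.18) level, any class family) `seq_Λ_eq_univ_of_last` · `seq_Ω_eq_univ_of_last` · ★ `seq_eq_top_of_Λ_last` ∕ `seq_eq_top_iff_Λ_last` (an admissible index whose LAST small-field
  region is the whole lattice IS `Seq.top`: the chain (2.1) is antitone and `Λ_j ⊆ Ω_j`) · `not_keyOldLargeField_length_iff_eq_top` (a key cut AT its length is good iff the index is `top`);
* §2 (the reading, top policy `fun K ↦ K₀ + K`, `0 < θ.τ9.M`, `1 ≤ K₀ + K`) `keyA₁₃_injective` · `keyA₁₃_not_mem_badClass₁₃_topCut_iff` (run A: good ⟺ `s = top`) ·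
  `keyB₁₃_not_mem_badClass₁₃_topCut_iff` (run B: good ⟺ `s' = top` one cutoff up; gen 0's exactness `blockDownSet_seq_Λ_succ_eq_univ_iff`) · `twoRunKeyB_top_eq_twoRunKeyA_top` ·
  `keyB₁₃_top` (run B's top maps to run A's top KEY, flow-free) · ★ `classSet₁₃_sdiff_badClass₁₃_topCut` (the GOOD class is the SINGLETON `{keyA₁₃ … top}`) · `badClass₁₃_topCut_eq_erase`;
* §3 (weights at the small-field key) `weightA₁₃_topKey` (= the (2.18) term of `top`, dag-n20-w3's `weightA₁₃_keyA`) · `eq_top_of_keyB₁₃_eq_keyA₁₃_top` · `weightB₁₃_topKey` (= run B's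
  (2.18) term of ITS `top`: the key fibre is a singleton, flow-free) · `sum_badClass₁₃_topCut_weightA ∕ _weightB` (bad mass = total − small-field term; selector-free);
* §4 (the face, live line) `badMass_topCut_eq_schemeZ_sub_left ∕ _right` (bad mass `= Z − sf`, E1∕E2) · ★★ `smallField_ge_topCut_left ∕ _right` (`(1 − W K) · Z_{K₀+K}(t) ≤ sf_A(t)`,
  `(1 − W K) · Z_{K₀+K+1}(t) ≤ sf_B(t)` with the reading's canonical `W`, hypothesis-free beyond the live line — so the N20 face (`W < 1`, `Σ W < ∞`, CLAIM-2's
  `relWeightBound_crOfRecord₁₃VAt_iff`) says THE PURE SMALL-FIELD TERM CARRIES AT LEAST THE FRACTION `1 − W K → 1` OF EACH DRESSED PARTITION FUNCTION, summably) · ★★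
  `W_topCut_eq_sSup_smallFieldDefect` (the canonical weight at the top cut `= sup_{|t| ≤ 1} max (1 − sf_A∕Z, 1 − sf_B∕Z')` — CLAIM-3's formula with the bad mass rewritten; with
  CLAIM-2's iff this is King's (3.10)–(3.11) AT THE RECORD: those worst-source small-field defects are `< 1` and summable, no residual letter).
WHAT IT SAYS FOR THE STUB (located, count-neutral): the dial's three marked points now read — `jc = 0`: N20 free, N19′ = NE7 on every history (gen 0); `jc = K₀ + K`: N20 = small-field
dominance with summable defect (this file; in `d = 4` at large volume the content dag-n20-w3's LOCATED-1 (2) ∕ dag-n20-w1's saturation wall speak against), N19′ = matching of the two PURE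
SMALL-FIELD terms ([B13]–[B15]'s perturbative regime); `jc > K₀ + K`: impossible (CLAIM-1).  The located NE7b content of record is a cut reading STRICTLY inside.
Cited BY NAME, not re-typed: `B14Eq218Concrete` (`Seq`, `Seq.top`, `Chain21.Λ_antitone`), dag-n20-d `Node00/TwoRunSite{Key,Lift,Persistence}` + `…SpineReadingOfRecord13CoPH(V)`, gen 0
`…N20TwoRunKeyedPersistentWeight` (`keyOldLargeField_twoRunKeyA∕B_iff_last`, `blockDownSet_seq_Λ_succ_eq_univ_iff`), dag-n20-w1 `…SocketAtRecord13CoPH` (`keyA₁₃_mem_classSet₁₃`,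
`keyB₁₃_mem_classSet₁₃`, `key*_mem_badClass₁₃_iff`), dag-n20-w3 `…CoreEdgeAtShellSplitOfRecord.weightA₁₃_keyA`, CLAIM-2∕3 of this seat.

HONEST FRAMING.  Finite combinatorics ∕ finite-sum bookkeeping; NO weight bounded, NO estimate proved; a located reading of the registered stub text at ONE policy, count-neutral.  It does
NOT say the top cut is the right dial setting — it says what N20 would assert there.  Nothing of Bałaban's is asserted; NE7 ∕ NE7b ∕ NE7c NOT PRINTED for `d = 4`, NOT proved;
(α)-instance 0∕1; no `Provisos₁₃CoPH` inhabitant claimed (K0⁷ OPEN); N19 ∕ N20 ∕ N21 ∕ N27 NOT discharged; K3⁷ NOT closed; counts unmoved (typed 28∕28 · discharged 5∕27); no count claim.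
One finite `𝕋⁴_{L^K}` programme at fixed `ε = L^{−K}`, Bałaban AS PRINTED; the YM mass gap (Clay) is NOT proved by any of this — R4 closes the conditional finite-𝕋⁴ rung `BalabanLadder.UV`
only; NOT ℝ⁴, NOT infinite volume, NOT OS.  No `def`, no `instance`, no `notation`, no `sorry`.  Sources (locators, bookkeeping only): [III] (2.1) p.254, (2.18) p.257; [LF-I] (0.2)–(0.4)
p.176; [LF-II] Thm 1 + (0.1) pp.355–356, (1.80) p.384; [King1986] (3.10)–(3.11) p.656.
-/

noncomputable section

open scoped BigOperators

namespace Summit.QuantumFields.YangMills.BalabanUVNodes.N20KeyedRelWeightTopCut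

open Literature.MathematicalPhysics.QuantumFieldTheory.Balaban1983to89 Literature.MathematicalPhysics.QuantumFieldTheory.Balaban1983to89.Node00
open T4Continuum B14.Eq218Concrete
open T4WeightBudget (RelWeightBound)
open YMDAG.UVSplit hiding SU
open Summit.QuantumFields.YangMills.BalabanUVNodes.SpineCanonicalWeights
open Summit.QuantumFields.YangMills.Theorems.N20AtRecord13 (schemeZ_pos_datumOfRecord₁₃CoPH)
open Summit.QuantumFields.YangMills.BalabanUVNodes.N20KeyedRelWeightSocketAtRecord13CoPH
  (keyA₁₃_mem_classSet₁₃ keyB₁₃_mem_classSet₁₃ keyA₁₃_mem_badClass₁₃_iff keyB₁₃_mem_badClass₁₃_iff)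
open Summit.QuantumFields.YangMills.BalabanUVNodes.N21KeyedShellWeightShellZero (zeta_nonneg_of_provisos₁₃CoPH weightA₁₃_nonneg weightB₁₃_nonneg)
open Summit.QuantumFields.YangMills.BalabanUVNodes.N20TwoRunKeyedPersistentWeight
  (seq_exists_Λ_ne_univ_iff_last keyOldLargeField_twoRunKeyA_iff_last keyOldLargeField_twoRunKeyB_iff_last blockDownSet_seq_Λ_succ_eq_univ_iff)
open Summit.QuantumFields.YangMills.BalabanUVNodes.N20CoreEdgeAtShellSplit (weightA₁₃_keyA)
open Summit.QuantumFields.YangMills.BalabanUVNodes.N20KeyedRelWeightCanonical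
open Summit.QuantumFields.YangMills.BalabanUVNodes.N20KeyedRelWeightFraction

/-! ## §1  (2.18) level: an admissible index whose LAST small-field region is the whole lattice IS the no-large-field index -/

section SeqTop

variable {α : Type*} {D : ℕ → Set (Set α)} {k : ℕ}

/-- Along (2.1) the small-field regions decrease, so `Λ_k = T_η` forces `Λ_j = T_η` at every window level. [cite: Balaban1988Convergent, (2.1) p.254 (bookkeeping)] -/
theorem seq_Λ_eq_univ_of_last (s : Seq D k) (h : s.Λ k = Set.univ) {j : ℕ} (h1 : 1 ≤ j) (hj : j ≤ k) : s.Λ j = Set.univ :=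
  Set.eq_univ_of_univ_subset (h ▸ s.chain.Λ_antitone h1 hj le_rfl)

/-- … and `Ω_j = T_η` too (`Λ_j ⊆ Ω_j`). [cite: Balaban1988Convergent, (2.1) p.254 (bookkeeping)] -/
theorem seq_Ω_eq_univ_of_last (s : Seq D k) (h : s.Λ k = Set.univ) {j : ℕ} (h1 : 1 ≤ j) (hj : j ≤ k) : s.Ω j = Set.univ :=
  Set.eq_univ_of_univ_subset ((seq_Λ_eq_univ_of_last s h h1 hj) ▸ s.chain.Λ_subset j h1 hj)

/-- **★ AN ADMISSIBLE INDEX WITH `Λ_k = T_η` IS THE NO-LARGE-FIELD INDEX `Seq.top`.** [cite: Balaban1988Convergent, (2.1) p.255, (2.18) p.257; Balaban1989LargeFieldI, (0.2) p.176 (bookkeeping)] -/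
theorem seq_eq_top_of_Λ_last (huniv : ∀ j, 1 ≤ j → j ≤ k → (Set.univ : Set α) ∈ D j) (s : Seq D k) (h : s.Λ k = Set.univ) : s = Seq.top D k huniv := by
  apply Seq.ext'
  · funext j
    by_cases hj : 1 ≤ j ∧ j ≤ k
    · rw [seq_Ω_eq_univ_of_last s h hj.1 hj.2]
      simp [Seq.top, hj.1, hj.2]
    · rw [s.Ω_off j hj, (Seq.top D k huniv).Ω_off j hj]
  · funext j
    by_cases hj : 1 ≤ j ∧ j ≤ k
    · rw [seq_Λ_eq_univ_of_last s h hj.1 hj.2]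
      simp [Seq.top, hj.1, hj.2]
    · rw [s.Λ_off j hj, (Seq.top D k huniv).Λ_off j hj]

/-- **`s = top ⟺ Λ_k = T_η`** (`k ≥ 1`). [cite: Balaban1988Convergent, (2.1) p.255; Balaban1989LargeFieldI, (0.2) p.176 (bookkeeping)] -/
theorem seq_eq_top_iff_Λ_last (huniv : ∀ j, 1 ≤ j → j ≤ k → (Set.univ : Set α) ∈ D j) (hk : 1 ≤ k) (s : Seq D k) : s = Seq.top D k huniv ↔ s.Λ k = Set.univ :=
  ⟨fun h => h ▸ Seq.top_Λ huniv hk, seq_eq_top_of_Λ_last huniv s⟩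

/-- **A KEY CUT AT ITS OWN LENGTH IS GOOD IFF THE INDEX IS `top`** (`k ≥ 1`): «no large-field region at any level `≤ k`» ⟺ `Λ_k = T_η` ⟺ `s = top`.
[cite: Balaban1989LargeFieldII, (1.80) p.384; Balaban1989LargeFieldI, (0.2) p.176 (bookkeeping)] -/
theorem not_keyOldLargeField_length_iff_eq_top (huniv : ∀ j, 1 ≤ j → j ≤ k → (Set.univ : Set α) ∈ D j) (hk : 1 ≤ k) (s : Seq D k) :
    ¬ KeyOldLargeField k (seqKey s) ↔ s = Seq.top D k huniv := by
  rw [keyOldLargeField_seqKey_iff, seq_exists_Λ_ne_univ_iff_last s hk le_rfl, not_not, seq_eq_top_iff_Λ_last huniv hk]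

end SeqTop

/-! ## §2  At the reading of record with the TOP policy `fun K ↦ K₀ + K`: the good class is the single all-small-field key -/

section Reading

variable {F : T4Family} {N : ℕ} [NeZero N] (θ : Stage13HParams F N) (K₀ : ℕ) (g₀ : ℕ → ℝ)

/-- Run A's σ-packed key of record is injective (run A's key forgets nothing: `seqKey_injective`). [cite: Balaban1988Convergent, (2.18) p.257 (bookkeeping)] -/
theorem keyA₁₃_injective (K : ℕ) : Function.Injective (keyA₁₃ θ K₀ g₀ K) := by
  intro s₁ s₂ h
  unfold keyA₁₃ at h
  exact twoRunKeyA_injective F θ.ν θ.τ9.M _ (K₀ + K) (K₀ + K) (eq_of_heq (Sigma.mk.inj_iff.1 h).2)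

variable (hM : 0 < θ.τ9.M)

/-- **RUN A AT THE TOP CUT: a key is GOOD iff its index is the no-large-field index** (`1 ≤ K₀ + K`). [cite: Balaban1989LargeFieldII, (1.80) p.384; Balaban1989LargeFieldI, (0.2) p.176 (bookkeeping)] -/
theorem keyA₁₃_not_mem_badClass₁₃_topCut_iff (K : ℕ) (hK : 1 ≤ K₀ + K) (t : ℝ) (s : SeqOfRecord F θ.ν θ.τ9.M (histA₁₃ θ K₀ g₀ K) (K₀ + K) (K₀ + K)) :
    keyA₁₃ θ K₀ g₀ K s ∉ badClass₁₃ θ K₀ g₀ (fun K => K₀ + K) K t ↔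
      s = Seq.top (DOfRecord F θ.ν θ.τ9.M (histA₁₃ θ K₀ g₀ K) (K₀ + K)) (K₀ + K) fun j _ _ => univ_mem_dOfRecord F θ.ν hM (histA₁₃ θ K₀ g₀ K) (K₀ + K) j := by
  rw [keyA₁₃_mem_badClass₁₃_iff]
  exact not_keyOldLargeField_length_iff_eq_top _ hK s

/-- **RUN B AT THE TOP CUT: a key is GOOD iff its index is the no-large-field index ONE CUTOFF UP** (`1 ≤ K₀ + K`; gen 0's exactness of the block-down on `𝐃^B_{j+1}`).
[cite: Balaban1989LargeFieldII, (1.80) p.384; Balaban1989LargeFieldI, (0.2) p.176; Balaban1988Convergent, (2.1) p.254 (bookkeeping)] -/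
theorem keyB₁₃_not_mem_badClass₁₃_topCut_iff (K : ℕ) (hK : 1 ≤ K₀ + K) (t : ℝ) (s' : SeqOfRecord F θ.ν θ.τ9.M (histB₁₃ θ K₀ g₀ K) (K₀ + K + 1) (K₀ + K + 1)) :
    keyB₁₃ θ K₀ g₀ K s' ∉ badClass₁₃ θ K₀ g₀ (fun K => K₀ + K) K t ↔
      s' = Seq.top (DOfRecord F θ.ν θ.τ9.M (histB₁₃ θ K₀ g₀ K) (K₀ + K + 1)) (K₀ + K + 1) fun j _ _ => univ_mem_dOfRecord F θ.ν hM (histB₁₃ θ K₀ g₀ K) (K₀ + K + 1) j := by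
  rw [keyB₁₃_mem_badClass₁₃_iff, keyB₁₃_eq θ K₀ g₀ hM K s']
  show ¬ KeyOldLargeField (K₀ + K) (twoRunKeyB F θ.ν hM (histB₁₃ θ K₀ g₀ K) (K₀ + K) (K₀ + K) s') ↔ _
  rw [keyOldLargeField_twoRunKeyB_iff_last F θ.ν hM _ (K₀ + K) (K₀ + K) hK le_rfl s', not_not, seq_eq_top_iff_Λ_last _ (by omega)]

/-- **RUN B's TOP MAPS TO RUN A's TOP KEY, FLOW-FREE** (`twoRunKeyB top = twoRunKeyA top`: both keys are `(T_η, …, T_η; T_η, …, T_η)` on the window and `∅` off it — the block-down of the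
whole torus is the whole torus). [cite: Balaban1988Convergent, (2.18) p.257; Balaban1987RG1, (0.3) p.252 (bookkeeping)] -/
theorem twoRunKeyB_top_eq_twoRunKeyA_top (ν : Stage7Numerics) {M : ℕ} (hM : 0 < M) (gA gB : ℕ → ℝ) (K k : ℕ) :
    twoRunKeyB F ν hM gB K k (Seq.top (DOfRecord F ν M gB (K + 1)) (k + 1) fun j _ _ => univ_mem_dOfRecord F ν hM gB (K + 1) j) =
      twoRunKeyA F ν M gA K k (Seq.top (DOfRecord F ν M gA K) k fun j _ _ => univ_mem_dOfRecord F ν hM gA K j) := by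
  refine Prod.ext (funext fun j => ?_) (funext fun j => ?_)
  · by_cases hj : 1 ≤ j ∧ j ≤ k
    · rw [twoRunKeyB_fst F ν hM gB K k _ hj.1 hj.2]
      simp [twoRunKeyA, seqKey, Seq.top, hj.1, hj.2, show j + 1 ≤ k + 1 by omega, blockDownSet_univ]
    · rw [twoRunKeyB_fst_off F ν hM gB K k _ hj]
      exact ((Seq.top (DOfRecord F ν M gA K) k fun j _ _ => univ_mem_dOfRecord F ν hM gA K j).Ω_off j hj).symm
  · by_cases hj : 1 ≤ j ∧ j ≤ k
    · rw [twoRunKeyB_snd F ν hM gB K k _ hj.1 hj.2]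
      simp [twoRunKeyA, seqKey, Seq.top, hj.1, hj.2, show j + 1 ≤ k + 1 by omega, blockDownSet_univ]
    · exact ((truncShift F ν hM gB (Seq.top (DOfRecord F ν M gB (K + 1)) (k + 1) fun j _ _ => univ_mem_dOfRecord F ν hM gB (K + 1) j)).Λ_off j hj).trans
        ((Seq.top (DOfRecord F ν M gA K) k fun j _ _ => univ_mem_dOfRecord F ν hM gA K j).Λ_off j hj).symm

/-- **AT THE RECORD: run B's top key of record IS run A's top key of record** (`0 < θ.τ9.M`). [cite: Balaban1988Convergent, (2.18) p.257 (bookkeeping)] -/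
theorem keyB₁₃_top (K : ℕ) :
    keyB₁₃ θ K₀ g₀ K (Seq.top (DOfRecord F θ.ν θ.τ9.M (histB₁₃ θ K₀ g₀ K) (K₀ + K + 1)) (K₀ + K + 1) fun j _ _ => univ_mem_dOfRecord F θ.ν hM (histB₁₃ θ K₀ g₀ K) (K₀ + K + 1) j) =
      keyA₁₃ θ K₀ g₀ K (Seq.top (DOfRecord F θ.ν θ.τ9.M (histA₁₃ θ K₀ g₀ K) (K₀ + K)) (K₀ + K) fun j _ _ => univ_mem_dOfRecord F θ.ν hM (histA₁₃ θ K₀ g₀ K) (K₀ + K) j) := by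
  rw [keyB₁₃_eq θ K₀ g₀ hM K]
  unfold keyA₁₃
  rw [twoRunKeyB_top_eq_twoRunKeyA_top θ.ν hM (histA₁₃ θ K₀ g₀ K) (histB₁₃ θ K₀ g₀ K) (K₀ + K) (K₀ + K)]

/-- Membership in the class set of record: a run-A key or a run-B key. [cite: Balaban1988Convergent, (2.18) p.257 (bookkeeping)] -/
theorem mem_classSet₁₃_iff (K : ℕ) (x : Σ K, SiteSeqKey F (K₀ + K)) :
    x ∈ classSet₁₃ θ K₀ g₀ K ↔ (∃ s, keyA₁₃ θ K₀ g₀ K s = x) ∨ ∃ s', keyB₁₃ θ K₀ g₀ K s' = x := by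
  letI : ∀ Kc, DecidableEq (SiteSeqKey F Kc) := fun _ => Classical.decEq _
  unfold classSet₁₃
  simp only [Finset.mem_union, Finset.mem_image, Finset.mem_univ, true_and]

/-- **★ AT THE TOP CUT THE GOOD CLASS OF THE READING OF RECORD IS THE SINGLE ALL-SMALL-FIELD KEY** (`0 < θ.τ9.M`, `1 ≤ K₀ + K`): `classSet₁₃ … K ∖ badClass₁₃ … (fun K ↦ K₀ + K) K t
= {keyA₁₃ … K top}`. [cite: King1986, (3.10) p.656; Balaban1989LargeFieldI, (0.2) p.176; Balaban1989LargeFieldII, (1.80) p.384 (bookkeeping)] -/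
theorem classSet₁₃_sdiff_badClass₁₃_topCut [DecidableEq (Σ K, SiteSeqKey F (K₀ + K))] (K : ℕ) (hK : 1 ≤ K₀ + K) (t : ℝ) :
    classSet₁₃ θ K₀ g₀ K \ badClass₁₃ θ K₀ g₀ (fun K => K₀ + K) K t =
      {keyA₁₃ θ K₀ g₀ K (Seq.top (DOfRecord F θ.ν θ.τ9.M (histA₁₃ θ K₀ g₀ K) (K₀ + K)) (K₀ + K) fun j _ _ => univ_mem_dOfRecord F θ.ν hM (histA₁₃ θ K₀ g₀ K) (K₀ + K) j)} := by
  ext x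
  simp only [Finset.mem_sdiff, Finset.mem_singleton]
  constructor
  · rintro ⟨hx, hnb⟩
    rcases (mem_classSet₁₃_iff θ K₀ g₀ K x).1 hx with ⟨s, rfl⟩ | ⟨s', rfl⟩
    · rw [(keyA₁₃_not_mem_badClass₁₃_topCut_iff θ K₀ g₀ hM K hK t s).1 hnb]
    · rw [(keyB₁₃_not_mem_badClass₁₃_topCut_iff θ K₀ g₀ hM K hK t s').1 hnb, keyB₁₃_top θ K₀ g₀ hM K]
  · rintro rfl
    exact ⟨keyA₁₃_mem_classSet₁₃ θ K₀ g₀ K _, (keyA₁₃_not_mem_badClass₁₃_topCut_iff θ K₀ g₀ hM K hK t _).2 rfl⟩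

/-- … equivalently the persistence class at the top cut is the class set with the small-field key ERASED. [cite: King1986, (3.10) p.656; Balaban1989LargeFieldII, (1.80) p.384 (bookkeeping)] -/
theorem badClass₁₃_topCut_eq_erase [DecidableEq (Σ K, SiteSeqKey F (K₀ + K))] (K : ℕ) (hK : 1 ≤ K₀ + K) (t : ℝ) :
    badClass₁₃ θ K₀ g₀ (fun K => K₀ + K) K t =
      (classSet₁₃ θ K₀ g₀ K).erase (keyA₁₃ θ K₀ g₀ K (Seq.top (DOfRecord F θ.ν θ.τ9.M (histA₁₃ θ K₀ g₀ K) (K₀ + K)) (K₀ + K)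
        fun j _ _ => univ_mem_dOfRecord F θ.ν hM (histA₁₃ θ K₀ g₀ K) (K₀ + K) j)) := by
  rw [← Finset.sdiff_singleton_eq_erase, ← classSet₁₃_sdiff_badClass₁₃_topCut θ K₀ g₀ hM K hK t,
    Finset.sdiff_sdiff_eq_self (badClass₁₃_subset θ K₀ g₀ _ K t)]

end Reading

/-! ## §3  The keyed weights of record AT the small-field key: the two runs' pure small-field (2.18) terms -/

section Weights

variable {F : T4Family} {N : ℕ} [NeZero N] (θ : Stage13HParams F N) (hP : θ.Provisos₁₃CoPH F N) (K₀ : ℕ) (g₀ : ℕ → ℝ) (os : List (ULoop F))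
  (hM : 0 < θ.τ9.M)

/-- **run A's KEYED WEIGHT OF RECORD AT THE SMALL-FIELD KEY IS THE (2.18) TERM OF `top`** — the pure small-field term `ρ(∅, ·)` of [LF-I] (0.2) at cutoff `K₀ + K` (dag-n20-w3's
`weightA₁₃_keyA`: run A's key fibres are singletons). [cite: Balaban1989LargeFieldI, (0.2) p.176; Balaban1988Convergent, (2.18) p.257 (bookkeeping)] -/
theorem weightA₁₃_topKey (K : ℕ) (t : ℝ) :
    weightA₁₃ θ hP K₀ g₀ os K t (keyA₁₃ θ K₀ g₀ K (Seq.top (DOfRecord F θ.ν θ.τ9.M (histA₁₃ θ K₀ g₀ K) (K₀ + K)) (K₀ + K)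
        fun j _ _ => univ_mem_dOfRecord F θ.ν hM (histA₁₃ θ K₀ g₀ K) (K₀ + K) j)) =
      classWeightOfDatum₉ F N θ.toStage9Params (datumOfRecord₁₃CoPH F N θ hP) g₀ os (runA₁₃ F K₀ g₀ K) (histA₁₃ θ K₀ g₀ K) (K₀ + K) t
        (Seq.top (DOfRecord F θ.ν θ.τ9.M (histA₁₃ θ K₀ g₀ K) (K₀ + K)) (K₀ + K) fun j _ _ => univ_mem_dOfRecord F θ.ν hM (histA₁₃ θ K₀ g₀ K) (K₀ + K) j) :=
  weightA₁₃_keyA θ hP K₀ g₀ os K t _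

/-- **A RUN-B INDEX KEYED TO THE SMALL-FIELD KEY IS run B's `top`** (`1 ≤ K₀ + K`; flow-free: the key fibre over the top key is a singleton).
[cite: Balaban1989LargeFieldI, (0.2) p.176; Balaban1988Convergent, (2.1) p.254, (2.18) p.257 (bookkeeping)] -/
theorem eq_top_of_keyB₁₃_eq_keyA₁₃_top (K : ℕ) (hK : 1 ≤ K₀ + K) (s' : SeqOfRecord F θ.ν θ.τ9.M (histB₁₃ θ K₀ g₀ K) (K₀ + K + 1) (K₀ + K + 1))
    (h : keyB₁₃ θ K₀ g₀ K s' = keyA₁₃ θ K₀ g₀ K (Seq.top (DOfRecord F θ.ν θ.τ9.M (histA₁₃ θ K₀ g₀ K) (K₀ + K)) (K₀ + K)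
      fun j _ _ => univ_mem_dOfRecord F θ.ν hM (histA₁₃ θ K₀ g₀ K) (K₀ + K) j)) :
    s' = Seq.top (DOfRecord F θ.ν θ.τ9.M (histB₁₃ θ K₀ g₀ K) (K₀ + K + 1)) (K₀ + K + 1) fun j _ _ => univ_mem_dOfRecord F θ.ν hM (histB₁₃ θ K₀ g₀ K) (K₀ + K + 1) j := by
  have hgood : keyB₁₃ θ K₀ g₀ K s' ∉ badClass₁₃ θ K₀ g₀ (fun K => K₀ + K) K 0 := by
    rw [h]
    exact (keyA₁₃_not_mem_badClass₁₃_topCut_iff θ K₀ g₀ hM K hK 0 _).2 rfl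
  exact (keyB₁₃_not_mem_badClass₁₃_topCut_iff θ K₀ g₀ hM K hK 0 s').1 hgood

/-- **run B's KEYED WEIGHT OF RECORD AT THE SMALL-FIELD KEY IS THE (2.18) TERM OF run B's `top`** — the pure small-field term at cutoff `K₀ + K + 1` (`1 ≤ K₀ + K`; the key fibre is
the singleton `{top}`, flow-free, `Finset.sum_eq_single_of_mem`). [cite: Balaban1989LargeFieldI, (0.2) p.176; Balaban1988Convergent, (2.18) p.257 (bookkeeping)] -/
theorem weightB₁₃_topKey (K : ℕ) (hK : 1 ≤ K₀ + K) (t : ℝ) :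
    weightB₁₃ θ hP K₀ g₀ os K t (keyA₁₃ θ K₀ g₀ K (Seq.top (DOfRecord F θ.ν θ.τ9.M (histA₁₃ θ K₀ g₀ K) (K₀ + K)) (K₀ + K)
        fun j _ _ => univ_mem_dOfRecord F θ.ν hM (histA₁₃ θ K₀ g₀ K) (K₀ + K) j)) =
      classWeightOfDatum₉ F N θ.toStage9Params (datumOfRecord₁₃CoPH F N θ hP) g₀ os (runB₁₃ F K₀ g₀ K) (histB₁₃ θ K₀ g₀ K) (K₀ + K + 1) t
        (Seq.top (DOfRecord F θ.ν θ.τ9.M (histB₁₃ θ K₀ g₀ K) (K₀ + K + 1)) (K₀ + K + 1) fun j _ _ => univ_mem_dOfRecord F θ.ν hM (histB₁₃ θ K₀ g₀ K) (K₀ + K + 1) j) := by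
  letI : ∀ Kc, DecidableEq (SiteSeqKey F Kc) := fun _ => Classical.decEq _
  unfold weightB₁₃
  rw [Finset.sum_eq_single_of_mem
    (Seq.top (DOfRecord F θ.ν θ.τ9.M (histB₁₃ θ K₀ g₀ K) (K₀ + K + 1)) (K₀ + K + 1) fun j _ _ => univ_mem_dOfRecord F θ.ν hM (histB₁₃ θ K₀ g₀ K) (K₀ + K + 1) j)]
  · exact Finset.mem_filter.2 ⟨Finset.mem_univ _, keyB₁₃_top θ K₀ g₀ hM K⟩
  · intro b hb hne
    exact absurd (eq_top_of_keyB₁₃_eq_keyA₁₃_top θ K₀ g₀ hM K hK b (Finset.mem_filter.1 hb).2) hne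

/-- **AT THE TOP CUT THE PERSISTENCE CLASS's run-A MASS IS THE TOTAL MINUS THE SMALL-FIELD TERM** (selector-free). [cite: King1986, (3.10) p.656; Balaban1989LargeFieldI, (0.2) p.176 (bookkeeping)] -/
theorem sum_badClass₁₃_topCut_weightA (K : ℕ) (hK : 1 ≤ K₀ + K) (t : ℝ) :
    ∑ x ∈ badClass₁₃ θ K₀ g₀ (fun K => K₀ + K) K t, weightA₁₃ θ hP K₀ g₀ os K t x =
      (∑ x ∈ classSet₁₃ θ K₀ g₀ K, weightA₁₃ θ hP K₀ g₀ os K t x) -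
        classWeightOfDatum₉ F N θ.toStage9Params (datumOfRecord₁₃CoPH F N θ hP) g₀ os (runA₁₃ F K₀ g₀ K) (histA₁₃ θ K₀ g₀ K) (K₀ + K) t
          (Seq.top (DOfRecord F θ.ν θ.τ9.M (histA₁₃ θ K₀ g₀ K) (K₀ + K)) (K₀ + K) fun j _ _ => univ_mem_dOfRecord F θ.ν hM (histA₁₃ θ K₀ g₀ K) (K₀ + K) j) := by
  classical
  rw [badClass₁₃_topCut_eq_erase θ K₀ g₀ hM K hK t, Finset.sum_erase_eq_sub (keyA₁₃_mem_classSet₁₃ θ K₀ g₀ K _), weightA₁₃_topKey θ hP K₀ g₀ os hM K t]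

/-- **… AND run B's.** [cite: King1986, (3.10) p.656; Balaban1989LargeFieldI, (0.2) p.176 (bookkeeping)] -/
theorem sum_badClass₁₃_topCut_weightB (K : ℕ) (hK : 1 ≤ K₀ + K) (t : ℝ) :
    ∑ x ∈ badClass₁₃ θ K₀ g₀ (fun K => K₀ + K) K t, weightB₁₃ θ hP K₀ g₀ os K t x =
      (∑ x ∈ classSet₁₃ θ K₀ g₀ K, weightB₁₃ θ hP K₀ g₀ os K t x) -
        classWeightOfDatum₉ F N θ.toStage9Params (datumOfRecord₁₃CoPH F N θ hP) g₀ os (runB₁₃ F K₀ g₀ K) (histB₁₃ θ K₀ g₀ K) (K₀ + K + 1) t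
          (Seq.top (DOfRecord F θ.ν θ.τ9.M (histB₁₃ θ K₀ g₀ K) (K₀ + K + 1)) (K₀ + K + 1) fun j _ _ => univ_mem_dOfRecord F θ.ν hM (histB₁₃ θ K₀ g₀ K) (K₀ + K + 1) j) := by
  classical
  rw [badClass₁₃_topCut_eq_erase θ K₀ g₀ hM K hK t, Finset.sum_erase_eq_sub (keyA₁₃_mem_classSet₁₃ θ K₀ g₀ K _), weightB₁₃_topKey θ hP K₀ g₀ os hM K hK t]

end Weights

/-! ## §4  The N20 face at the top cut on a live tuple: the pure small-field term exhausts both dressed partition functions up to the fraction `W K`, `Σ W < ∞` -/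

section Face

variable {F : T4Family} {N : ℕ} [NeZero N] (θ : Stage13HParams F N) (hP : θ.Provisos₁₃CoPH F N) (K₀ : ℕ) (g₀ : ℕ → ℝ) (os : List (ULoop F))
  (hM : 0 < θ.τ9.M) (E : B12.RunParams → ℝ)
  (hsel : θ.ppSel = ppSelLiveOfRecord F N θ.ν θ.τ9 E (wOfRecord₉ F N θ.toStage9Params)) (hU : LocalBgMeasurable F N θ.ν) (hζm : ZetaMeasurable F N θ.ζ)
include hsel hU hζm

/-- **ON THE LIVE LINE THE PERSISTENCE CLASS's run-A MASS AT THE TOP CUT IS `Z_{K₀+K}(t) − sf_A(t)`** (E1). [cite: Balaban1985UV3, (6) p.257; Balaban1989LargeFieldI, (0.2) p.176; King1986, (3.10) p.656 (bookkeeping)] -/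
theorem badMass_topCut_eq_schemeZ_sub_left (K : ℕ) (hK : 1 ≤ K₀ + K) (t : ℝ) :
    ∑ x ∈ badClass₁₃ θ K₀ g₀ (fun K => K₀ + K) K t, weightA₁₃ θ hP K₀ g₀ os K t x =
      T4GenFunBounds.schemeZ ((datumOfRecord₁₃CoPH F N θ hP).scheme g₀) os (K₀ + K) t -
        classWeightOfDatum₉ F N θ.toStage9Params (datumOfRecord₁₃CoPH F N θ hP) g₀ os (runA₁₃ F K₀ g₀ K) (histA₁₃ θ K₀ g₀ K) (K₀ + K) t
          (Seq.top (DOfRecord F θ.ν θ.τ9.M (histA₁₃ θ K₀ g₀ K) (K₀ + K)) (K₀ + K) fun j _ _ => univ_mem_dOfRecord F θ.ν hM (histA₁₃ θ K₀ g₀ K) (K₀ + K) j) := by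
  rw [sum_badClass₁₃_topCut_weightA θ hP K₀ g₀ os hM K hK t,
    schemeZ_eq_sum_classSet_weightA K₀ θ hP E hsel hU hζm (zeta_nonneg_of_provisos₁₃CoPH F θ hP) g₀ os K t]

/-- **… AND run B's IS `Z_{K₀+K+1}(t) − sf_B(t)`** (E2). [cite: Balaban1985UV3, (6) p.257; Balaban1989LargeFieldI, (0.2) p.176; King1986, (3.10) p.656 (bookkeeping)] -/
theorem badMass_topCut_eq_schemeZ_sub_right (K : ℕ) (hK : 1 ≤ K₀ + K) (t : ℝ) :
    ∑ x ∈ badClass₁₃ θ K₀ g₀ (fun K => K₀ + K) K t, weightB₁₃ θ hP K₀ g₀ os K t x =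
      T4GenFunBounds.schemeZ ((datumOfRecord₁₃CoPH F N θ hP).scheme g₀) os (K₀ + K + 1) t -
        classWeightOfDatum₉ F N θ.toStage9Params (datumOfRecord₁₃CoPH F N θ hP) g₀ os (runB₁₃ F K₀ g₀ K) (histB₁₃ θ K₀ g₀ K) (K₀ + K + 1) t
          (Seq.top (DOfRecord F θ.ν θ.τ9.M (histB₁₃ θ K₀ g₀ K) (K₀ + K + 1)) (K₀ + K + 1) fun j _ _ => univ_mem_dOfRecord F θ.ν hM (histB₁₃ θ K₀ g₀ K) (K₀ + K + 1) j) := by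
  rw [sum_badClass₁₃_topCut_weightB θ hP K₀ g₀ os hM K hK t,
    schemeZ_succ_eq_sum_classSet_weightB K₀ θ hP E hsel hU hζm (zeta_nonneg_of_provisos₁₃CoPH F θ hP) g₀ os K t]

variable (sh : ShellSplit₁₃CoPH N K₀)

/-- **★★ AT THE TOP CUT THE PURE SMALL-FIELD TERM CARRIES AT LEAST THE FRACTION `1 − W K` OF run A's DRESSED PARTITION FUNCTION** on `|t| ≤ 1` (the reading's canonical `W` is always
admissible — CLAIM-3's `badMass_le_W_mul_schemeZ_left` — and the bad mass is `Z − sf`): `(1 − W K) · Z_{K₀+K}(t) ≤ sf_A(t)`.  With the N20 face (`W K < 1`, `Σ W < ∞`, CLAIM-2's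
`relWeightBound_crOfRecord₁₃VAt_iff`) this is SMALL-FIELD DOMINANCE WITH SUMMABLE DEFECT — King's (3.10)–(3.11) at the record.
[cite: King1986, (3.10)–(3.11) p.656; Balaban1989LargeFieldI, (0.2)–(0.4) p.176; Balaban1989LargeFieldII, Thm 1 + (0.1) pp.355–356 (bookkeeping)] -/
theorem smallField_ge_topCut_left (K : ℕ) (hK : 1 ≤ K₀ + K) {t : ℝ} (ht : |t| ≤ 1) :
    (1 - (crOfRecord₁₃VAt K₀ (fun K => K₀ + K) sh F θ hP g₀ os).W K) * T4GenFunBounds.schemeZ ((datumOfRecord₁₃CoPH F N θ hP).scheme g₀) os (K₀ + K) t ≤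
      classWeightOfDatum₉ F N θ.toStage9Params (datumOfRecord₁₃CoPH F N θ hP) g₀ os (runA₁₃ F K₀ g₀ K) (histA₁₃ θ K₀ g₀ K) (K₀ + K) t
        (Seq.top (DOfRecord F θ.ν θ.τ9.M (histA₁₃ θ K₀ g₀ K) (K₀ + K)) (K₀ + K) fun j _ _ => univ_mem_dOfRecord F θ.ν hM (histA₁₃ θ K₀ g₀ K) (K₀ + K) j) := by
  have h := badMass_le_W_mul_schemeZ_left θ hP K₀ g₀ os E hsel hU hζm (fun K => K₀ + K) sh K ht
  rw [badMass_topCut_eq_schemeZ_sub_left θ hP K₀ g₀ os hM E hsel hU hζm K hK t] at h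
  linarith

/-- **★★ … AND OF run B's**: `(1 − W K) · Z_{K₀+K+1}(t) ≤ sf_B(t)`. [cite: King1986, (3.10)–(3.11) p.656; Balaban1989LargeFieldI, (0.2)–(0.4) p.176; Balaban1989LargeFieldII, Thm 1 + (0.1) pp.355–356 (bookkeeping)] -/
theorem smallField_ge_topCut_right (K : ℕ) (hK : 1 ≤ K₀ + K) {t : ℝ} (ht : |t| ≤ 1) :
    (1 - (crOfRecord₁₃VAt K₀ (fun K => K₀ + K) sh F θ hP g₀ os).W K) * T4GenFunBounds.schemeZ ((datumOfRecord₁₃CoPH F N θ hP).scheme g₀) os (K₀ + K + 1) t ≤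
      classWeightOfDatum₉ F N θ.toStage9Params (datumOfRecord₁₃CoPH F N θ hP) g₀ os (runB₁₃ F K₀ g₀ K) (histB₁₃ θ K₀ g₀ K) (K₀ + K + 1) t
        (Seq.top (DOfRecord F θ.ν θ.τ9.M (histB₁₃ θ K₀ g₀ K) (K₀ + K + 1)) (K₀ + K + 1) fun j _ _ => univ_mem_dOfRecord F θ.ν hM (histB₁₃ θ K₀ g₀ K) (K₀ + K + 1) j) := by
  have h := badMass_le_W_mul_schemeZ_right θ hP K₀ g₀ os E hsel hU hζm (fun K => K₀ + K) sh K ht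
  rw [badMass_topCut_eq_schemeZ_sub_right θ hP K₀ g₀ os hM E hsel hU hζm K hK t] at h
  linarith

/-- **★★ THE CANONICAL WEIGHT AT THE TOP CUT IS THE WORST-SOURCE SMALL-FIELD DEFECT**: `W K = sup_{|t| ≤ 1} max (1 − sf_A(t) ∕ Z_{K₀+K}(t)) (1 − sf_B(t) ∕ Z_{K₀+K+1}(t))` (`1 ≤ K₀ + K`;
CLAIM-3's `W_crOfRecord₁₃VAt_eq_sSup_badFrac` with the bad mass rewritten).  The N20 face of K3⁷ v3 stub 2 at the top of the window therefore reads, by CLAIM-2's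
`relWeightBound_crOfRecord₁₃VAt_iff`: these worst-source defects are `< 1` at every step and SUMMABLE over `K` — King's (3.10)–(3.11) at the record, no residual letter.
[cite: King1986, (3.10)–(3.11) p.656; Balaban1989LargeFieldI, (0.2)–(0.4) p.176; Balaban1989LargeFieldII, Thm 1 + (0.1) pp.355–356, (1.80) p.384 (bookkeeping)] -/
theorem W_topCut_eq_sSup_smallFieldDefect (K : ℕ) (hK : 1 ≤ K₀ + K) :
    (crOfRecord₁₃VAt K₀ (fun K => K₀ + K) sh F θ hP g₀ os).W K =
      sSup ((fun t : ℝ => max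
          (1 - classWeightOfDatum₉ F N θ.toStage9Params (datumOfRecord₁₃CoPH F N θ hP) g₀ os (runA₁₃ F K₀ g₀ K) (histA₁₃ θ K₀ g₀ K) (K₀ + K) t
                  (Seq.top (DOfRecord F θ.ν θ.τ9.M (histA₁₃ θ K₀ g₀ K) (K₀ + K)) (K₀ + K) fun j _ _ => univ_mem_dOfRecord F θ.ν hM (histA₁₃ θ K₀ g₀ K) (K₀ + K) j) /
                T4GenFunBounds.schemeZ ((datumOfRecord₁₃CoPH F N θ hP).scheme g₀) os (K₀ + K) t)
          (1 - classWeightOfDatum₉ F N θ.toStage9Params (datumOfRecord₁₃CoPH F N θ hP) g₀ os (runB₁₃ F K₀ g₀ K) (histB₁₃ θ K₀ g₀ K) (K₀ + K + 1) t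
                  (Seq.top (DOfRecord F θ.ν θ.τ9.M (histB₁₃ θ K₀ g₀ K) (K₀ + K + 1)) (K₀ + K + 1) fun j _ _ => univ_mem_dOfRecord F θ.ν hM (histB₁₃ θ K₀ g₀ K) (K₀ + K + 1) j) /
                T4GenFunBounds.schemeZ ((datumOfRecord₁₃CoPH F N θ hP).scheme g₀) os (K₀ + K + 1) t)) ''
        {t : ℝ | |t| ≤ 1}) := by
  rw [W_crOfRecord₁₃VAt_eq_sSup_badFrac θ hP K₀ g₀ os E hsel hU hζm (fun K => K₀ + K) sh K]
  congr 1
  refine Set.image_congr fun t _ => ?_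
  have hZA := schemeZ_pos_datumOfRecord₁₃CoPH θ hP g₀ os (K₀ + K) t
  have hZB := schemeZ_pos_datumOfRecord₁₃CoPH θ hP g₀ os (K₀ + K + 1) t
  rw [badMass_topCut_eq_schemeZ_sub_left θ hP K₀ g₀ os hM E hsel hU hζm K hK t, badMass_topCut_eq_schemeZ_sub_right θ hP K₀ g₀ os hM E hsel hU hζm K hK t,
    sub_div, div_self hZA.ne', sub_div, div_self hZB.ne']

end Face

/-! ## §5 (v1.1, append-only) The CORE face at the top cut: ONE sandwich between the two runs' pure small-field terms (the N19′ twin of §4; offered to dag-n20-w3 on the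
bus l.28281 after its g2 ■, typed here) -/

section CoreFace

open Summit.QuantumFields.BalabanUV.T4Continuum.Spine

variable {F : T4Family} {N : ℕ} [NeZero N] (θ : Stage13HParams F N) (hP : θ.Provisos₁₃CoPH F N) (K₀ : ℕ) (g₀ : ℕ → ℝ) (os : List (ULoop F))
  (hM : 0 < θ.τ9.M)

/-- **AT THE TOP CUT A CLAUSE «FOR EVERY GOOD KEY» IS THE CLAUSE AT THE SMALL-FIELD KEY** (`1 ≤ K₀ + K`; §2's singleton). [cite: King1986, (3.10) p.656; Balaban1989LargeFieldI, (0.2) p.176 (bookkeeping)] -/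
theorem forall_goodClass_topCut_iff [DecidableEq (Σ K, SiteSeqKey F (K₀ + K))] (K : ℕ) (hK : 1 ≤ K₀ + K) (t : ℝ) (Pr : (Σ K, SiteSeqKey F (K₀ + K)) → Prop) :
    (∀ x ∈ classSet₁₃ θ K₀ g₀ K \ badClass₁₃ θ K₀ g₀ (fun K => K₀ + K) K t, Pr x) ↔
      Pr (keyA₁₃ θ K₀ g₀ K (Seq.top (DOfRecord F θ.ν θ.τ9.M (histA₁₃ θ K₀ g₀ K) (K₀ + K)) (K₀ + K) fun j _ _ => univ_mem_dOfRecord F θ.ν hM (histA₁₃ θ K₀ g₀ K) (K₀ + K) j)) := by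
  rw [classSet₁₃_sdiff_badClass₁₃_topCut θ K₀ g₀ hM K hK t]
  simp only [Finset.mem_singleton, forall_eq]

/-- **★★ THE N19′ CORE AT THE TOP CUT IS ONE SANDWICH PER STEP AT THE SMALL-FIELD KEY** (offset `K₀ ≥ 1`, so that every step has `1 ≤ K₀ + K`; any cores `P, Q`, volume letter, rate):
`NE7.Core 1 vol (classSet₁₃ …) (badClass₁₃ … (fun K ↦ K₀ + K)) P Q δ ⟺ ∀ K, ∃ c, ∀ |t| ≤ 1, e^{c − vol·δ_K}·P K t (key top) ≤ Q K t (key top) ≤ e^{c + vol·δ_K}·P K t (key top)`.  With `P, Q` the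
reading's cores `weightA₁₃ − shA`, `weightB₁₃ − shB` and §3's `weight*₁₃_topKey`, this is the matching of the two runs' PURE SMALL-FIELD (2.18) terms (minus their shells) — the [B13]–[B15]
perturbative regime; at the record's own offset `K₀ = 0` use `forall_goodClass_topCut_iff` step by step for `K ≥ 1` (step `0` is the zero cut there). [cite: Balaban1989LargeFieldI, (0.2)–(0.4) p.176; Balaban1989LargeFieldII, Thm 1 + (0.1) pp.355–356; King1986, (3.10) p.656 (bookkeeping)] -/
theorem core_topCut_iff_smallFieldKey [DecidableEq (Σ K, SiteSeqKey F (K₀ + K))] (hK₀ : 1 ≤ K₀) (vol : ℝ) (P Q : ℕ → ℝ → (Σ K, SiteSeqKey F (K₀ + K)) → ℝ) (δ : ℕ → ℝ) :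
    NE7.Core 1 vol (classSet₁₃ θ K₀ g₀) (badClass₁₃ θ K₀ g₀ (fun K => K₀ + K)) P Q δ ↔
      ∀ K : ℕ, ∃ c : ℝ, ∀ t : ℝ, |t| ≤ 1 →
        Real.exp (c - vol * δ K) *
            P K t (keyA₁₃ θ K₀ g₀ K (Seq.top (DOfRecord F θ.ν θ.τ9.M (histA₁₃ θ K₀ g₀ K) (K₀ + K)) (K₀ + K) fun j _ _ => univ_mem_dOfRecord F θ.ν hM (histA₁₃ θ K₀ g₀ K) (K₀ + K) j)) ≤
          Q K t (keyA₁₃ θ K₀ g₀ K (Seq.top (DOfRecord F θ.ν θ.τ9.M (histA₁₃ θ K₀ g₀ K) (K₀ + K)) (K₀ + K) fun j _ _ => univ_mem_dOfRecord F θ.ν hM (histA₁₃ θ K₀ g₀ K) (K₀ + K) j)) ∧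
        Q K t (keyA₁₃ θ K₀ g₀ K (Seq.top (DOfRecord F θ.ν θ.τ9.M (histA₁₃ θ K₀ g₀ K) (K₀ + K)) (K₀ + K) fun j _ _ => univ_mem_dOfRecord F θ.ν hM (histA₁₃ θ K₀ g₀ K) (K₀ + K) j)) ≤
          Real.exp (c + vol * δ K) *
            P K t (keyA₁₃ θ K₀ g₀ K (Seq.top (DOfRecord F θ.ν θ.τ9.M (histA₁₃ θ K₀ g₀ K) (K₀ + K)) (K₀ + K) fun j _ _ => univ_mem_dOfRecord F θ.ν hM (histA₁₃ θ K₀ g₀ K) (K₀ + K) j)) := by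
  refine forall_congr' fun K => exists_congr fun c => forall_congr' fun t => forall_congr' fun _ => ?_
  exact forall_goodClass_topCut_iff θ K₀ g₀ hM K (by omega) t _

/-- **THE CORE AT THE TOP CUT, READ AT THE SPINE READING OF RECORD's OWN CORES** (`weightA₁₃ − shA`, `weightB₁₃ − shB`; `K₀ ≥ 1`): step by step ONE sandwich between run A's pure small-field
term minus its shell and run B's pure small-field term minus its shell (§3's `weightA₁₃_topKey` ∕ `weightB₁₃_topKey`). [cite: Balaban1989LargeFieldI, (0.2)–(0.4) p.176; Balaban1989LargeFieldII, Thm 1 + (0.1) pp.355–356 (bookkeeping)] -/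
theorem core_topCut_reading_iff_smallFieldTerms [DecidableEq (Σ K, SiteSeqKey F (K₀ + K))] (hK₀ : 1 ≤ K₀) (vol : ℝ) (sh : ShellSplit₁₃CoPH N K₀) (δ : ℕ → ℝ) :
    NE7.Core 1 vol (classSet₁₃ θ K₀ g₀) (badClass₁₃ θ K₀ g₀ (fun K => K₀ + K))
        (fun K t x => weightA₁₃ θ hP K₀ g₀ os K t x - (sh F θ hP g₀ os).1 K t x) (fun K t x => weightB₁₃ θ hP K₀ g₀ os K t x - (sh F θ hP g₀ os).2 K t x) δ ↔
      ∀ K : ℕ, ∃ c : ℝ, ∀ t : ℝ, |t| ≤ 1 →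
        Real.exp (c - vol * δ K) *
            (classWeightOfDatum₉ F N θ.toStage9Params (datumOfRecord₁₃CoPH F N θ hP) g₀ os (runA₁₃ F K₀ g₀ K) (histA₁₃ θ K₀ g₀ K) (K₀ + K) t
                (Seq.top (DOfRecord F θ.ν θ.τ9.M (histA₁₃ θ K₀ g₀ K) (K₀ + K)) (K₀ + K) fun j _ _ => univ_mem_dOfRecord F θ.ν hM (histA₁₃ θ K₀ g₀ K) (K₀ + K) j) -
              (sh F θ hP g₀ os).1 K t (keyA₁₃ θ K₀ g₀ K (Seq.top (DOfRecord F θ.ν θ.τ9.M (histA₁₃ θ K₀ g₀ K) (K₀ + K)) (K₀ + K)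
                fun j _ _ => univ_mem_dOfRecord F θ.ν hM (histA₁₃ θ K₀ g₀ K) (K₀ + K) j))) ≤
          classWeightOfDatum₉ F N θ.toStage9Params (datumOfRecord₁₃CoPH F N θ hP) g₀ os (runB₁₃ F K₀ g₀ K) (histB₁₃ θ K₀ g₀ K) (K₀ + K + 1) t
              (Seq.top (DOfRecord F θ.ν θ.τ9.M (histB₁₃ θ K₀ g₀ K) (K₀ + K + 1)) (K₀ + K + 1) fun j _ _ => univ_mem_dOfRecord F θ.ν hM (histB₁₃ θ K₀ g₀ K) (K₀ + K + 1) j) -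
            (sh F θ hP g₀ os).2 K t (keyA₁₃ θ K₀ g₀ K (Seq.top (DOfRecord F θ.ν θ.τ9.M (histA₁₃ θ K₀ g₀ K) (K₀ + K)) (K₀ + K)
              fun j _ _ => univ_mem_dOfRecord F θ.ν hM (histA₁₃ θ K₀ g₀ K) (K₀ + K) j)) ∧
        classWeightOfDatum₉ F N θ.toStage9Params (datumOfRecord₁₃CoPH F N θ hP) g₀ os (runB₁₃ F K₀ g₀ K) (histB₁₃ θ K₀ g₀ K) (K₀ + K + 1) t
              (Seq.top (DOfRecord F θ.ν θ.τ9.M (histB₁₃ θ K₀ g₀ K) (K₀ + K + 1)) (K₀ + K + 1) fun j _ _ => univ_mem_dOfRecord F θ.ν hM (histB₁₃ θ K₀ g₀ K) (K₀ + K + 1) j) -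
            (sh F θ hP g₀ os).2 K t (keyA₁₃ θ K₀ g₀ K (Seq.top (DOfRecord F θ.ν θ.τ9.M (histA₁₃ θ K₀ g₀ K) (K₀ + K)) (K₀ + K)
              fun j _ _ => univ_mem_dOfRecord F θ.ν hM (histA₁₃ θ K₀ g₀ K) (K₀ + K) j)) ≤
          Real.exp (c + vol * δ K) *
            (classWeightOfDatum₉ F N θ.toStage9Params (datumOfRecord₁₃CoPH F N θ hP) g₀ os (runA₁₃ F K₀ g₀ K) (histA₁₃ θ K₀ g₀ K) (K₀ + K) t
                (Seq.top (DOfRecord F θ.ν θ.τ9.M (histA₁₃ θ K₀ g₀ K) (K₀ + K)) (K₀ + K) fun j _ _ => univ_mem_dOfRecord F θ.ν hM (histA₁₃ θ K₀ g₀ K) (K₀ + K) j) -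
              (sh F θ hP g₀ os).1 K t (keyA₁₃ θ K₀ g₀ K (Seq.top (DOfRecord F θ.ν θ.τ9.M (histA₁₃ θ K₀ g₀ K) (K₀ + K)) (K₀ + K)
                fun j _ _ => univ_mem_dOfRecord F θ.ν hM (histA₁₃ θ K₀ g₀ K) (K₀ + K) j))) := by
  rw [core_topCut_iff_smallFieldKey θ K₀ g₀ hM hK₀]
  refine forall_congr' fun K => exists_congr fun c => forall_congr' fun t => forall_congr' fun _ => ?_
  rw [weightA₁₃_topKey θ hP K₀ g₀ os hM K t, weightB₁₃_topKey θ hP K₀ g₀ os hM K (by omega) t]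

end CoreFace

end Summit.QuantumFields.YangMills.BalabanUVNodes.N20KeyedRelWeightTopCut

end
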